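import Summits.ResolutionOfSingularities.ResolutionOfSingularities.Theorems.HilbertSamuelEliminationCampaignW42PermissibleRidgeFibreCone
import Summits.ResolutionOfSingularities.ResolutionOfSingularities.Theorems.HilbertSamuelEliminationCampaignW42TangentConeOfPermissible
import Summits.ResolutionOfSingularities.ResolutionOfSingularities.Theorems.HilbertSamuelEliminationCampaignW42RidgeChangeOfGenerators
import HarnessLib

/-!
# [OURS · L1 W4.2] `RidgeConfinesChart A c N` HOLDS for every permissible centre: the typed OURS confinement
# (p480040 `CampaignW42.RidgeConfinesChart`, tangent-cone ridge `localRidge A`, chart algebra form) proved for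
# `A` noetherian local universally catenary and `(c)` permissible — every chart, every point of the fibre, every residue
# field, every characteristic (campaign s42, cell res-hironaka; informal crux `RidgeConfinement`,
# stmt-ResolutionOfSingularities-17845; `--supports`)

HONEST FRAMING. OURS (slot W4.2, prover res-L1-s42-pv-1, gen 3): the assembly of this campaign's general case INTO THE TYPED
OURS PREDICATE of `…CampaignW42RidgeConfinement.lean` (res-L1-type-o1, p480040, lane-signed):

* **`CampaignW42.ridgeConfinedAt_of_isNearRing`** — for `(A, 𝔫, k)` noetherian local universally catenary,
  `𝔭 = (c_1, …, c_k)` PERMISSIBLE (`𝔭` prime, `A/𝔭` regular, `A` normally flat along `𝔭`), a chart `j`, a prime `𝔴` of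
  `A[𝔭/c_j]` over `𝔫` whose local ring is NEAR to `A` at level `N`: `RidgeConfinedAt A c κ(𝔴) (ē_l)_l` — there is a
  `κ(𝔴)`-point `v` of Giraud's ridge `F(A) = F(C_x X)` (tree `localRidge A`, in the FIXED minimal generators of `𝔫`) whose
  value on every degree-one initial form of `c_l` is `ē_l = c_l/c_j mod 𝔴`;
* **`CampaignW42.ridgeConfinesChart_of_isPermissible`** — hence **`RidgeConfinesChart A c N`** for all `N`.

Chain: near ⟹ the direction `ū = (ē_l)_l` lies in the ridge of the FIBRE cone `F(C_{X,D,x})(κ)`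
(`…PermissibleRidgeFibreCone`) ⟹ `(0, ū) ∈ F(V(I(c)·k[T,Y]))(κ) = F(V(I(y,c)))(κ)` by Hironaka–Grothendieck at the near
point (`…TangentConeOfPermissible`: `I(y,c) = I(c)·k[T,Y]`, `𝔫 = 𝔭 + (y)`), i.e. a point of the ridge of the tangent cone
read in the generators `(y, c)` (`…TangentConeGenerators`: `I(y,c) = J_{(y,c)}`) ⟹ transported to the minimal generators
(`…RidgeChangeOfGenerators`) it is a point `v ∈ localRidge A κ` with `Σ_i b̄_{li} v_i = ū_l`, and `Σ_i b̄_{li} X_i` IS a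
degree-one initial form of `c_l` (all of them agree on `v`, which kills `J_x ⊇ W_1`).

What this does NOT do: the scheme-level `CampaignW42RidgeConfines p` (stalks of an `IsBlowup` as localizations of the
chart algebras, `IsPermissible` ⟹ the ring-level hypotheses, universal catenarity of the stalks of a scheme of finite
type over a field) is the remaining glue. NOTHING here is a statement of H. Hironaka's manuscript [Hironaka2017]. AI review
is weaker than expert review. References (orientation only): V. Cossart, U. Jannsen, S. Saito, LNM 2270 (2020), Thm. 3.14,
Rem. 18.29; J. Giraud, Ann. Sci. ÉNS 8 (1975), Cor. 2.4.
-/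

noncomputable section

-- single-conjunct summit: the doubled namespace component `ResolutionOfSingularities` is mandated
set_option linter.dupNamespace false

open IsLocalRing MvPolynomial
open Literature.RingTheory.HilbertSamuel Literature.RingTheory.MvPolynomial
open Literature.AlgebraicGeometry.Resolution

namespace Summit.ResolutionOfSingularities.ResolutionOfSingularities.Theorems

namespace CampaignW42

universe u

variable {A : Type u} [CommRing A] [IsLocalRing A] [IsNoetherianRing A] {k : ℕ} (c : Fin k → A) (j : Fin k)

local notation3 "𝔭" => Ideal.span (Set.range c)

/-- **The typed point-level confinement at a near point of a permissible blow-up.** For `A` noetherian local universally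
catenary, `𝔭 = (c)` permissible, a prime `𝔴` of the chart `A[𝔭/c_j]` over `𝔫` whose local ring is near to `A` at level
`N`: `RidgeConfinedAt A c κ(𝔴) (c_l/c_j mod 𝔴)_l` for the `k`-algebra structure of `κ(𝔴)` induced by the chart
(`CampaignW42.RidgeConfinedAt`, p480040). [cite: CossartJannsenSaito2020, Thm. 3.14] [cite: Giraud1975, Cor. 2.4] -/
theorem ridgeConfinedAt_of_isNearRing (hO : IsUniversallyCatenaryRing A) [(𝔭).IsPrime] [IsRegularLocalRing (A ⧸ 𝔭)]
    (hNF : (𝔭).IsNormallyFlat) (𝔴 : Ideal (chartRing c j)) [𝔴.IsPrime]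
    (hπ : ∀ r ∈ maximalIdeal A,
      ((algebraMap (chartRing c j) (Ideal.ResidueField 𝔴)).comp (chartBase c j)) r = 0)
    {N : ℕ} (hnear : IsNearRing A (Localization.AtPrime 𝔴) N) :
    letI : Algebra (ResidueField A) (Ideal.ResidueField 𝔴) :=
      (Ideal.Quotient.lift (maximalIdeal A)
        ((algebraMap (chartRing c j) (Ideal.ResidueField 𝔴)).comp (chartBase c j)) hπ).toAlgebra
    RidgeConfinedAt A c (Ideal.ResidueField 𝔴)
      (fun l : Fin k =>
        (algebraMap (chartRing c j) (Ideal.ResidueField 𝔴) : chartRing c j →+* Ideal.ResidueField 𝔴)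
          (chartGen c j l)) := by
  classical
  letI algκ : Algebra (ResidueField A) (Ideal.ResidueField 𝔴) :=
    (Ideal.Quotient.lift (maximalIdeal A)
      ((algebraMap (chartRing c j) (Ideal.ResidueField 𝔴)).comp (chartBase c j)) hπ).toAlgebra
  letI algO : Algebra A (Localization.AtPrime 𝔴) :=
    ((algebraMap (chartRing c j) (Localization.AtPrime 𝔴)).comp (chartBase c j)).toAlgebra
  set κ := Ideal.ResidueField 𝔴
  set ubar : Fin k → κ := fun l =>
    (algebraMap (chartRing c j) (Ideal.ResidueField 𝔴) : chartRing c j →+* Ideal.ResidueField 𝔴) (chartGen c j l)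
    with hubar
  -- (1) the direction lies in the ridge of the FIBRE cone
  have hū : ubar ∈ ridge κ (fibreConeIdeal c) := residue_chartGen_mem_ridge_of_isNearRing c j hO hNF 𝔴 hπ hnear
  -- `𝔴` lies over `𝔫`
  have hP : 𝔴.comap (chartBase c j) = maximalIdeal A := by
    refine ((IsLocalRing.maximalIdeal.isMaximal A).eq_of_le (Ideal.IsPrime.ne_top inferInstance) fun r hr => ?_).symm
    rw [Ideal.mem_comap, ← Ideal.algebraMap_residueField_eq_zero]
    exact hπ r hr
  -- (2) generators `(y, c)` of `𝔫` adapted to the centre; Hironaka–Grothendieck at the near point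
  obtain ⟨s, hs⟩ := exists_ringKrullDim_quotient_eq_nat A (𝔭)
  obtain ⟨y, hy⟩ := exists_maximalIdeal_eq_sup_span_range (𝔭) hs
  have hc' : Ideal.span (Set.range (frontAppend y c)) = maximalIdeal A := by
    rw [span_range_frontAppend, sup_comm, ← hy]
  have hHG := fibreConeIdeal_frontAppend_eq_coneExtend_of_isNearRing c y j 𝔴 (Localization.AtPrime 𝔴) hO hs hNF hy hP
    (fun _ => rfl) hnear
  -- (3) `(0, ū)` is a point of the ridge of the tangent cone read in `(y, c)`
  have hw : frontAppend (0 : Fin s → κ) ubar ∈ ridge κ (tangentConeIdeal (frontAppend y c) hc') := by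
    rw [← fibreConeIdeal_eq_tangentConeIdeal (frontAppend y c) hc', hHG]
    exact frontAppend_zero_mem_ridge_coneExtend s hū
  -- (4) transport to the minimal generators `x = minGenerators A`
  set x := minGenerators A
  have hx : Ideal.span (Set.range x) = maximalIdeal A := span_range_minGenerators A
  have hxa : ∀ i, ∃ ai : Fin (k + s) → A, ∑ l, ai l * frontAppend y c l = x i := fun i =>
    Ideal.mem_span_range_iff_exists_fun.mp (by
      rw [hc', ← hx]; exact Ideal.subset_span ⟨i, rfl⟩)
  choose a ha using hxa
  have hxb : ∀ l, ∃ bl : Fin (maximalIdeal A).spanFinrank → A, ∑ i, bl i * x i = frontAppend y c l := fun l =>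
    Ideal.mem_span_range_iff_exists_fun.mp (by
      rw [hx, ← hc']; exact Ideal.subset_span ⟨l, rfl⟩)
  choose b hb using hxb
  obtain ⟨v, hv, hvw⟩ := exists_mem_ridge_of_mem_ridge_tangentConeIdeal hx rfl hc'
    (a := Matrix.of a) (fun i => by simpa using (ha i).symm)
    (b := Matrix.of b) (fun l => by simpa using (hb l).symm) hw
  -- (5) `v ∈ F(A)(κ)` takes the value `ū_l` on every degree-one initial form of `c_l`
  refine ⟨v, (mem_localRidge_iff A).mpr hv, fun l L hL => ?_⟩
  set L₀ : MvPolynomial (Fin (maximalIdeal A).spanFinrank) (ResidueField A) :=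
    ∑ i, C (residue A (b (l.addNat s) i)) * X i with hL₀
  have hL₀mem : L₀ ∈ initialFormsOf x (c l) 1 := by
    refine ⟨∑ i, C (b (l.addNat s) i) * X i, IsHomogeneous.sum _ _ _ fun i _ => isHomogeneous_C_mul_X _ i, ?_, ?_⟩
    · rw [← frontAppend_addNat y c l, ← hb (l.addNat s), map_sum]
      simp
    · simp [hL₀, map_sum]
  have hL₀v : aeval v L₀ = ubar l := by
    rw [← frontAppend_addNat (0 : Fin s → κ) ubar l, ← hvw (l.addNat s), hL₀, map_sum]
    simp [Matrix.of_apply]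
  have hdiff : aeval v (L - L₀) = 0 :=
    aeval_eq_zero_of_mem_ridge (tangentConeIdeal_le_ker_constantCoeff x hx) hv
      (mem_tangentConeIdeal_of_mem_symbolForms x hx 1 (sub_mem_symbolForms_of_mem_initialFormsOf x hx hL hL₀mem))
  rw [map_sub, sub_eq_zero] at hdiff
  rw [hdiff, hL₀v]

/-- **`RidgeConfinesChart A c N` holds for every permissible centre** (typed OURS predicate of p480040): for `A` noetherian
local universally catenary and `𝔭 = (c_1, …, c_k)` permissible, in every chart `j` of the blow-up of `Spec A` along `𝔭`,
every prime `𝔴` over `𝔫` whose local ring is near to `A` at level `N` has its tautological direction `(ē_l)_l` confined to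
Giraud's ridge `F(A)`. CJS Thm. 3.14 without the characteristic hypothesis, ridge in place of directrix, all points of the
fibre, all residue fields. [cite: CossartJannsenSaito2020, Thm. 3.14] [cite: Giraud1975, Cor. 2.4] -/
theorem ridgeConfinesChart_of_isPermissible (hO : IsUniversallyCatenaryRing A) [(𝔭).IsPrime]
    [IsRegularLocalRing (A ⧸ 𝔭)] (hNF : (𝔭).IsNormallyFlat) (N : ℕ) : RidgeConfinesChart A c N := by
  intro j 𝔴 _ hπ hnear
  exact ridgeConfinedAt_of_isNearRing c j hO hNF 𝔴 hπ hnear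

end CampaignW42

end Summit.ResolutionOfSingularities.ResolutionOfSingularities.Theorems

end
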